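import Literature.Geometry.ComplexAnalytic.RelativeExponentialChartEtaleOfMFDeriv    -- ★ p848606 `exists_localInverse_of_bijective_mfderiv`
import Mathlib.Algebra.Module.ZLattice.Basic
import HarnessLib

/-!
# Holomorphic continuation of a kernel vector of a relative exponential FLOW datum, with local uniqueness
# ([BirkenhakeLange2004] §1.1, Ch. 8 §8.7; [FritzscheGrauert2002] Ch. I §7 Thm. 7.6)

Layer `Literature/Geometry/ComplexAnalytic`, namespace `Literature.Geometry.ComplexAnalytic.RelExpFlow`.  THEOREMS ONLY (no definition, no
named fact, no instance, no notation, no `sorry`).  Cell `hodgecm-mathlib` (D-0151), FLOOR 0, P6 «MOD» (crux hLiu418 = stmt-HodgeConjecture-24832,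
`--supports`), «L8-PREP»: the ENGINE of letter (L2) «HOLOMORPHIC PERIODS» of LA1-plan (g2)
(`F0/P6/L1/LA1-plan/g2/RelativeExponentialFlowChart.letters.v1.lean` f624b8d3345ff64b :78), paid by LA7-p02 (g2); the letter itself is ★
`RelativeExponentialFlowChart.lean` (next file).  HC_CM is proved only modulo the 7 printed citations (2 remaining: hLiu418 = stmt-HodgeConjecture-24832,
h413 = stmt-HodgeConjecture-24833) until rung 0 closes; generic complex-analytic ∕ linear-algebraic lemmas, count-neutral.

SETTING (the tree's generic currency of ★ `IsRelExpChartOn`, flow datum unbundled): `ex : B × E → M` is `C^ω` on the open `U × E` (`hex`),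
lies over `p : M → B` (`hp`), and has bijective complex differential on `U × E` (`hbij`) — so `ex` is étale there (★ p848606).  The KERNEL FAMILY
is `{(v, w) ∈ U × E | ex (v, w) = ex (v, 0)}`; in print, the local system `R₁f_*ℤ ⊂ Lie(A∕S)` of [DeligneHodgeII1971] §4.4 (4.4.2).

* `exists_kernelSection` — HOLOMORPHIC CONTINUATION WITH LOCAL UNIQUENESS: for `m ∈ U` and a kernel vector `w₀` at `m` there are an open `G`,
  `m ∈ G ⊆ U`, and `s : B → E` holomorphic on `G` with `s m = w₀` and `ex (v, s v) = ex (v, 0)` on `G`, and a neighbourhood `O` of `(m, w₀)` in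
  which the kernel family IS the graph of `s` (`s v := pr₂ (e.symm (ex (v, 0)))` for the local inverse `e` of `ex` at `(m, w₀)`; `hp` pins the
  first coordinate; uniqueness = injectivity of `e` on its source).  [BirkenhakeLange2004] Ch. 8 §8.7 (period maps of families are holomorphic).
* `addSubgroup_of_frame` (a set `Φ₀ (ℤ^ι)` is a subgroup), `mdifferentiableOn_fintype_sum` (finite sums of holomorphic vector-valued maps, any
  index universe), `exists_int_eq_sum_of_ball` (REDUCTION INTO THE FUNDAMENTAL PARALLELEPIPED: if the vectors of a real basis `b` lie in a subgroup
  `H` and every element of `H` of norm `≤ R`, `R ≥ ∑ ‖b i‖`, is in `ℤ⟨b⟩`, then `H ⊆ ℤ⟨b⟩` — Mathlib `ZSpan.fract`, `ZSpan.norm_fract_le`).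

## References
* [BirkenhakeLange2004] C. Birkenhake, H. Lange, *Complex Abelian Varieties*, 2nd ed. (2004), §1.1; Ch. 8 §8.7.
* [FritzscheGrauert2002] K. Fritzsche, H. Grauert, *From Holomorphic Functions to Complex Manifolds* (2002), Ch. I §7 Thm. 7.6.
* [DeligneHodgeII1971] P. Deligne, *Théorie de Hodge II*, Publ. Math. IHÉS 40 (1971), §4.4 (4.4.2) p. 50.
-/

set_option autoImplicit false

noncomputable section

open scoped Manifold ContDiff Topology
open Set Function Filter Module Submodule

namespace Literature.Geometry.ComplexAnalytic

namespace RelExpFlow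

/-! ### §1 Plumbing -/

section Plumbing

variable {E : Type*} [NormedAddCommGroup E] [NormedSpace ℂ E] {ι : Type*}

/-- A subset of `E` of the form `Φ₀ (ℤ^ι)` (`Φ₀` real-linear) is an additive subgroup (non-Prop-free plumbing, stated as an `∃`).
[cite: BirkenhakeLange2004, §1.1 (a lattice is a subgroup)] -/
theorem addSubgroup_of_frame (Φ₀ : (ι → ℝ) ≃L[ℝ] E) {K : Set E}
    (hK : ∀ w : E, w ∈ K ↔ ∃ n : ι → ℤ, w = Φ₀ (fun i => (n i : ℝ))) :
    ∃ H : AddSubgroup E, ∀ w : E, w ∈ H ↔ w ∈ K := by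
  have h0 : (0 : E) ∈ K := (hK 0).2 ⟨0, by simp only [Pi.zero_apply, Int.cast_zero]; exact (map_zero Φ₀).symm⟩
  refine ⟨AddSubgroup.ofSub K ⟨0, h0⟩ ?_, fun w ↦ Iff.rfl⟩
  intro x hx y hy
  obtain ⟨n, rfl⟩ := (hK x).1 hx
  obtain ⟨n', rfl⟩ := (hK y).1 hy
  refine (hK _).2 ⟨n - n', ?_⟩
  rw [← sub_eq_add_neg, ← map_sub]
  congr 1
  funext i
  simp only [Pi.sub_apply, Int.cast_sub]

end Plumbing

section Sums

variable {EB : Type*} [NormedAddCommGroup EB] [NormedSpace ℂ EB]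
  {B : Type*} [TopologicalSpace B] [ChartedSpace EB B]
  {E : Type*} [NormedAddCommGroup E] [NormedSpace ℂ E]

/-- Finite sums of holomorphic `E`-valued maps are holomorphic (Mathlib's `MDifferentiableOn.sum` on an index type in any universe).
[cite: FritzscheGrauert2002, Ch. I §7 (holomorphic maps form a ring)] -/
theorem mdifferentiableOn_fintype_sum {ι : Type*} [Fintype ι] {f : ι → B → E} {s : Set B}
    (hf : ∀ i, MDifferentiableOn 𝓘(ℂ, EB) 𝓘(ℂ, E) (f i) s) :
    MDifferentiableOn 𝓘(ℂ, EB) 𝓘(ℂ, E) (fun v => ∑ i, f i v) s := by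
  classical
  suffices h : ∀ t : Finset ι, MDifferentiableOn 𝓘(ℂ, EB) 𝓘(ℂ, E) (fun v => ∑ i ∈ t, f i v) s from h Finset.univ
  intro t
  induction t using Finset.induction_on with
  | empty =>
    simp only [Finset.sum_empty]
    exact mdifferentiableOn_const
  | insert i t hi IH =>
    simp only [Finset.sum_insert hi]
    exact (hf i).add IH

end Sums

/-! ### §2 The holomorphic continuation of a kernel vector -/

section Continuation

variable {EB : Type*} [NormedAddCommGroup EB] [NormedSpace ℂ EB] [FiniteDimensional ℂ EB]
  {B : Type*} [TopologicalSpace B] [ChartedSpace EB B]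
  {E : Type*} [NormedAddCommGroup E] [NormedSpace ℂ E] [FiniteDimensional ℂ E]
  {EM : Type*} [NormedAddCommGroup EM] [NormedSpace ℂ EM]
  {M : Type*} [TopologicalSpace M] [ChartedSpace EM M]

/-- **Holomorphic continuation of a kernel vector, with local uniqueness.**  For a `C^ω` map `ex : B × E → M` over `p` on the open `U`
with bijective differential on `U × E`, a base point `m ∈ U` and a kernel vector `w₀` at `m` (`ex (m, w₀) = ex (m, 0)`): there are an open
`G`, `m ∈ G ⊆ U`, and `s : B → E`, holomorphic on `G`, with `s m = w₀` and `ex (v, s v) = ex (v, 0)` for `v ∈ G` (the continuation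
`s v = pr₂ (e.symm (ex (v, 0)))` through the local inverse `e` of `ex` at `(m, w₀)`), and a neighbourhood `O` of `(m, w₀)` such that every
kernel point `(v, w) ∈ O` (`ex (v, w) = ex (v, 0)`, `v ∈ G`) has `w = s v` — near `(m, w₀)` the kernel family is the graph of `s`.
[cite: BirkenhakeLange2004, Ch. 8 §8.7 (the period map of a family is holomorphic)] [cite: FritzscheGrauert2002, Ch. I §7 Thm. 7.6] -/
theorem exists_kernelSection [IsManifold 𝓘(ℂ, EB) ω B] [IsManifold 𝓘(ℂ, EM) ω M]
    {p : M → B} {U : Set B} {ex : B × E → M} (hU : IsOpen U)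
    (hex : ContMDiffOn (𝓘(ℂ, EB).prod 𝓘(ℂ, E)) 𝓘(ℂ, EM) ω ex (U ×ˢ (univ : Set E)))
    (hp : ∀ b ∈ U, ∀ z : E, p (ex (b, z)) = b)
    (hbij : ∀ q ∈ U ×ˢ (univ : Set E), Bijective (mfderiv (𝓘(ℂ, EB).prod 𝓘(ℂ, E)) 𝓘(ℂ, EM) ex q))
    {m : B} (hm : m ∈ U) {w₀ : E} (hw₀ : ex (m, w₀) = ex (m, 0)) :
    ∃ G : Set B, IsOpen G ∧ m ∈ G ∧ G ⊆ U ∧ ∃ s : B → E, s m = w₀ ∧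
      MDifferentiableOn 𝓘(ℂ, EB) 𝓘(ℂ, E) s G ∧ (∀ v ∈ G, ex (v, s v) = ex (v, 0)) ∧
      ∃ O ∈ 𝓝 ((m, w₀) : B × E), ∀ q ∈ O, q.1 ∈ G → ex q = ex (q.1, 0) → q.2 = s q.1 := by
  obtain ⟨e, hme, hsrc, heq, hsymm⟩ :=
    exists_localInverse_of_bijective_mfderiv (n := ω) (by simp) hU hex hbij (m, w₀) ⟨hm, mem_univ _⟩
  -- the base map `v ↦ ex (v, 0)` and the open set where it lands in the target of `e`
  have hexd : MDifferentiableOn (𝓘(ℂ, EB).prod 𝓘(ℂ, E)) 𝓘(ℂ, EM) ex (U ×ˢ (univ : Set E)) :=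
    hex.mdifferentiableOn (by simp)
  have h0d : MDifferentiableOn 𝓘(ℂ, EB) 𝓘(ℂ, EM) (fun v : B ↦ ex (v, (0 : E))) U := by
    have h1 : MDifferentiableOn 𝓘(ℂ, EB) (𝓘(ℂ, EB).prod 𝓘(ℂ, E)) (fun v : B ↦ ((v, (0 : E)) : B × E)) U :=
      mdifferentiableOn_id.prodMk mdifferentiableOn_const
    exact hexd.comp h1 fun v hv ↦ ⟨hv, mem_univ _⟩
  have h0c : ContinuousOn (fun v : B ↦ ex (v, (0 : E))) U := h0d.continuousOn
  set G : Set B := U ∩ (fun v : B ↦ ex (v, (0 : E))) ⁻¹' e.target with hG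
  have hGopen : IsOpen G := h0c.isOpen_inter_preimage hU e.open_target
  have hGU : G ⊆ U := inter_subset_left
  have hmG : m ∈ G := by
    refine ⟨hm, ?_⟩
    show ex (m, 0) ∈ e.target
    rw [← hw₀, ← heq _ hme]
    exact e.map_source hme
  -- the continuation
  set s : B → E := fun v ↦ (e.symm (ex (v, 0))).2 with hs
  have hkey : ∀ v ∈ G, e.symm (ex (v, 0)) = (v, s v) := by
    intro v hv
    have hq : e.symm (ex (v, 0)) ∈ e.source := e.map_target hv.2
    have hexq : ex (e.symm (ex (v, 0))) = ex (v, 0) := by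
      rw [← heq _ hq]
      exact e.right_inv hv.2
    have h1 : (e.symm (ex (v, 0))).1 = v := by
      have hpq := hp (e.symm (ex (v, 0))).1 (hsrc hq).1 (e.symm (ex (v, 0))).2
      rw [Prod.mk.eta, hexq, hp v (hGU hv)] at hpq
      exact hpq.symm
    exact Prod.ext h1 rfl
  refine ⟨G, hGopen, hmG, hGU, s, ?_, ?_, ?_, e.source, e.open_source.mem_nhds hme, ?_⟩
  · -- `s m = w₀`
    show (e.symm (ex (m, 0))).2 = w₀
    rw [← hw₀, ← heq _ hme, e.left_inv hme]
  · -- holomorphy on `G`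
    have hcomp : MDifferentiableOn 𝓘(ℂ, EB) (𝓘(ℂ, EB).prod 𝓘(ℂ, E)) (e.symm ∘ fun v : B ↦ ex (v, (0 : E))) G :=
      hsymm.comp (h0d.mono hGU) fun v hv ↦ hv.2
    intro v hv
    exact (hcomp v hv).snd
  · -- `s v` is a kernel vector
    intro v hv
    have hq : e.symm (ex (v, 0)) ∈ e.source := e.map_target hv.2
    have hexq : ex (e.symm (ex (v, 0))) = ex (v, 0) := by
      rw [← heq _ hq]
      exact e.right_inv hv.2
    rwa [hkey v hv] at hexq
  · -- local uniqueness inside `e.source`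
    intro q hq hq1 hqex
    have hq' : (q.1, s q.1) ∈ e.source := by
      rw [← hkey q.1 hq1]
      exact e.map_target hq1.2
    have h : e q = e (q.1, s q.1) := by
      rw [heq _ hq, heq _ hq', hqex, ← hkey q.1 hq1, ← heq _ (e.map_target hq1.2), e.right_inv hq1.2]
    have := e.injOn hq hq' h
    rw [Prod.ext_iff] at this
    exact this.2

end Continuation

/-! ### §3 Reduction into the fundamental parallelepiped -/

section Reduction

variable {F : Type*} [NormedAddCommGroup F] [NormedSpace ℝ F] {ι : Type*} [Fintype ι]

/-- **Reduction into the fundamental parallelepiped.**  Let `b` be a real basis of `F` whose vectors lie in the additive subgroup `H`, and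
`R ≥ ∑ ‖b i‖`.  If every element of `H` of norm `≤ R` lies in the `ℤ`-span of `b`, then EVERY element of `H` is an integer combination of
`b` (reduce modulo `ℤ⟨b⟩` with `ZSpan.fract`, `‖fract w‖ ≤ ∑ ‖b i‖`). [cite: BirkenhakeLange2004, §1.1 (fundamental parallelepiped of a lattice)] -/
theorem exists_int_eq_sum_of_ball (b : Basis ι ℝ F) (H : AddSubgroup F) (hb : ∀ i, b i ∈ H) {R : ℝ}
    (hR : ∑ i, ‖b i‖ ≤ R) (hball : ∀ y : F, ‖y‖ ≤ R → y ∈ H → y ∈ span ℤ (Set.range b))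
    {w : F} (hw : w ∈ H) :
    ∃ n : ι → ℤ, w = ∑ i, (n i : ℝ) • b i := by
  have hle : span ℤ (Set.range b) ≤ AddSubgroup.toIntSubmodule H := by
    rw [Submodule.span_le]
    rintro _ ⟨i, rfl⟩
    exact hb i
  have hfloor : (ZSpan.floor b w : F) ∈ H := hle (ZSpan.floor b w).2
  have hfractH : ZSpan.fract b w ∈ H := by
    rw [ZSpan.fract_apply]
    exact H.sub_mem hw hfloor
  have hfract : ZSpan.fract b w ∈ span ℤ (Set.range b) :=
    hball _ ((ZSpan.norm_fract_le b w).trans hR) hfractH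
  have hwspan : w ∈ span ℤ (Set.range b) := by
    have : w = ZSpan.fract b w + ZSpan.floor b w := by rw [ZSpan.fract_apply, sub_add_cancel]
    rw [this]
    exact add_mem hfract (ZSpan.floor b w).2
  refine ⟨fun i ↦ ⌊b.repr w i⌋, ?_⟩
  have hrepr : ∀ i, b.repr w i = (⌊b.repr w i⌋ : ℝ) := fun i ↦ by
    conv_lhs => rw [← ZSpan.floor_eq_self_of_mem b w hwspan]
    exact ZSpan.repr_floor_apply b w i
  calc w = ∑ i, b.repr w i • b i := (b.sum_repr w).symm
    _ = ∑ i, (⌊b.repr w i⌋ : ℝ) • b i := Finset.sum_congr rfl fun i _ ↦ by rw [← hrepr i]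

end Reduction

end RelExpFlow

end Literature.Geometry.ComplexAnalytic

end
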